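import Mathlib
import Summits.KontsevichZagierPeriods.Zeta5Search.CatalanQSumTwoAdicProof
import Summits.KontsevichZagierPeriods.Zeta5Search.SymmetricFamilyInnerSum
import HarnessLib

/-!
# Catalan box family — PROOF of the diagonal law (`CatalanQSum.DiagonalLaw`): `Q(n,n,n,n,n) = 8(−1)ⁿ uₙ` for all `n`

HONEST FRAMING: systematic search; no irrationality claim unless certified.

Cell `pub-zeta5`, planner seat `fam-catalan` (gen 6).  The tree's `CatalanQSum.DiagonalLaw` — the explicit `G`-coefficient of the
Catalan box family on the diagonal equals `8(−1)ⁿ uₙ`, `uₙ` the solution of Zudilin's 2003 Apéry-like recursion with `u₀ = 1,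
u₁ = 7/4` (`Literature.NumberTheory.Irrationality.Zudilin2003.u`, arXiv:math/0201024, eq. (2)–(4)) — was kernel-checked for
`n ≤ 50` only (`CatalanQSum.diagonal_eq_zudilin_u`).  Here it is PROVED for every `n` (`diagonalLaw_holds`).  Nothing in this
file is a statement about Catalan's constant; it is an identity between two explicitly defined sequences of rationals.

PROOF (creative telescoping, certificate found by the seat by linear algebra over `ℚ` and checked here by `ring` /
`linear_combination`; no `native_decide`).
(1) On the diagonal the tree's evaluator gives `Q(n,n,n,n,n) = 8(−1)ⁿ D(n)` with the single sum
`D(n) = ((½)ₙ/n!)² · ₃F₂(−n, −n, n+½; ½, ½; 1) = Σ_{i ≤ n} F(n,i)`,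
`F(n,i) = C(n+2,i)² (½)ₙ (½)ₙ₊ᵢ i! (n+2−i)² (n+1−i)² / ((n+2)!² ((½)ᵢ)²)` (`diagTerm`; `catalanQ_diagonal`, by matching the
term ratio of `f32Aux`).
(2) With `c₂(n) = (2n+3)²(2n+4)² p(n+1)`, `c₁(n) = q(n+1)`, `c₀(n) = (2n+1)²(2n+2)² p(n+2)` (`p, q` Zudilin's polynomials (3)) and
the certificate `G(n,i) = B(n,i)·P₇(n,i)·(i−½)²·i` (`diagCert`, `diagCertPoly` an explicit integer polynomial of degree 7),
`c₂ F(n+2,i) − c₁ F(n+1,i) − c₀ F(n,i) = G(n,i+1) − G(n,i)` for all `n, i` (`telescope_term`): the three shifted summands are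
`B(n,i) ×` explicit polynomials (`diagBase_succ_left`, `diagBase_succ_right`), and what is left is one polynomial identity
(`diagKey`, `ring`).  Summing over `i ≤ n+2` (`G(n,0) = G(n,n+3) = 0`) gives Zudilin's recursion (2) for `D` at index `n+1`
(`diagSum_isSolution`); `D(0) = 1`, `D(1) = 7/4`, and uniqueness (`Zudilin2003.IsSolution.ext_of_init`) give `D = u` (`diagSum_eq_u`).
COROLLARIES: `uₙ` is the terminating `₃F₂(1)` above (`zudilin_u_eq_f32`); with the tree's 2-adic law (`twoAdicLaw_holds`)
the exact valuation `v₂(uₙ) = 2·s₂(n) − 4n` for all `n` (`padicValRat_zudilin_u`; Zudilin, Sect. 4, observed `2^{4n} uₙ ∈ ℤ`).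
-/

open Finset

namespace Summit.KontsevichZagierPeriods.Zeta5Search.CatalanQSumDiagonal

open Literature.NumberTheory.Irrationality
open Summit.KontsevichZagierPeriods.Zeta5Search.CatalanQSum
open Summit.KontsevichZagierPeriods.Zeta5Search.SymmetricRecursion (choose_succ_left_cast choose_succ_right_cast)

/-! ### The diagonal summand -/

/-- The common factor `B(n,i) = C(n+2,i)² (½)ₙ (½)ₙ₊ᵢ i! / ((n+2)!² ((½)ᵢ)²)` of the three shifted summands and of the certificate. -/
def diagBase (n i : ℕ) : ℚ :=
  (((n + 2).choose i : ℕ) : ℚ) ^ 2 * poch (1 / 2) n * poch (1 / 2) (n + i) * ((i.factorial : ℕ) : ℚ)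
    / ((((n + 2).factorial : ℕ) : ℚ) ^ 2 * poch (1 / 2) i ^ 2)

/-- The summand `F(n,i) = B(n,i)·(n+2−i)²(n+1−i)²` `( = ((½)ₙ/n!)² C(n,i)² i! (n+½)ᵢ / ((½)ᵢ)² )`. -/
def diagTerm (n i : ℕ) : ℚ := diagBase n i * (((n : ℚ) + 2 - i) * ((n : ℚ) + 1 - i)) ^ 2

/-- The diagonal sum `D(n) = Σ_{i ≤ n} F(n,i)` `( = ((½)ₙ/n!)² ₃F₂(−n,−n,n+½;½,½;1) )`. -/
def diagSum (n : ℕ) : ℚ := ∑ i ∈ range (n + 1), diagTerm n i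

/-- `D(0) = 1 = u₀`. -/
theorem diagSum_zero : diagSum 0 = 1 := by
  decide +kernel

/-- `D(1) = 7/4 = u₁`. -/
theorem diagSum_one : diagSum 1 = 7 / 4 := by
  decide +kernel

/-! ### Ratio identities of `B(n,i)` -/

/-- Shift in `n`: `B(n+1,i)·(n+3−i)² = B(n,i)·(n+½)(n+i+½)`. -/
theorem diagBase_succ_left (n i : ℕ) :
    diagBase (n + 1) i * ((n : ℚ) + 3 - i) ^ 2 = diagBase n i * (((n : ℚ) + 1 / 2) * ((n : ℚ) + i + 1 / 2)) := by
  rcases lt_trichotomy i (n + 3) with hi | rfl | hi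
  · have h := choose_succ_left_cast (n + 2) i
    push_cast at h
    have hlt : (i : ℚ) < (n : ℚ) + 3 := by exact_mod_cast hi
    have hne : ((n : ℚ) + 2 + 1 - i) ≠ 0 := by intro h0; linarith
    have ha : (((n + 2 + 1).choose i : ℕ) : ℚ)
        = (((n + 2).choose i : ℕ) : ℚ) * ((n : ℚ) + 2 + 1) / ((n : ℚ) + 2 + 1 - i) := by
      rw [eq_div_iff hne]; exact h
    have hP : poch (1 / 2) i ≠ 0 := poch_oneHalf_ne_zero i
    have hE : (((n + 2).factorial : ℕ) : ℚ) ≠ 0 := by positivity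
    have h3 : ((n : ℚ) + 2 + 1) ≠ 0 := by positivity
    unfold diagBase
    rw [show n + 1 + 2 = n + 2 + 1 from rfl, show n + 1 + i = n + i + 1 by omega, Nat.factorial_succ (n + 2), ha]
    simp only [poch]
    push_cast
    field_simp
    ring
  · simp [diagBase]
  · have h0 : (n + 2).choose i = 0 := Nat.choose_eq_zero_of_lt (by omega)
    have h1 : (n + 1 + 2).choose i = 0 := Nat.choose_eq_zero_of_lt (by omega)
    simp [diagBase, h0, h1]

/-- Shift in `i`: `B(n,i+1)·(i+1)(i+½)² = B(n,i)·(n+i+½)(n+2−i)²`. -/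
theorem diagBase_succ_right (n i : ℕ) :
    diagBase n (i + 1) * (((i : ℚ) + 1) * ((i : ℚ) + 1 / 2) ^ 2)
      = diagBase n i * (((n : ℚ) + i + 1 / 2) * ((n : ℚ) + 2 - i) ^ 2) := by
  have h := choose_succ_right_cast (n + 2) i
  push_cast at h
  have hi1 : ((i : ℚ) + 1) ≠ 0 := by positivity
  have ha : (((n + 2).choose (i + 1) : ℕ) : ℚ) = (((n + 2).choose i : ℕ) : ℚ) * ((n : ℚ) + 2 - i) / ((i : ℚ) + 1) := by
    rw [eq_div_iff hi1]; exact h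
  have hP : poch (1 / 2) i ≠ 0 := poch_oneHalf_ne_zero i
  have hP1 : (1 / 2 + (i : ℚ)) ≠ 0 := by positivity
  have hE : (((n + 2).factorial : ℕ) : ℚ) ≠ 0 := by positivity
  unfold diagBase
  rw [show n + (i + 1) = n + i + 1 from rfl, Nat.factorial_succ i, ha]
  simp only [poch]
  push_cast
  field_simp
  ring

/-- Shift in `i` for the summand: `F(n,i+1)·(i+1)(i+½)² = F(n,i)·(n+i+½)(n−i)²` — the term ratio of `₃F₂(−n,−n,n+½;½,½;1)`. -/
theorem diagTerm_succ_right (n i : ℕ) :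
    diagTerm n (i + 1) * (((i : ℚ) + 1) * ((i : ℚ) + 1 / 2) ^ 2)
      = diagTerm n i * (((n : ℚ) + i + 1 / 2) * ((n : ℚ) - i) ^ 2) := by
  have h := diagBase_succ_right n i
  unfold diagTerm
  push_cast
  linear_combination ((((n : ℚ) + 2 - (i + 1)) * ((n : ℚ) + 1 - (i + 1))) ^ 2) * h

/-! ### The diagonal of the tree's evaluator is `8(−1)ⁿ D(n)` -/

/-- The `i`-th term of the evaluator of `₃F₂(−n,−n,n+½;½,½;1)`, times `((½)ₙ/n!)²`, is `F(n,i)` (`i ≤ n`). -/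
theorem f32Aux_fst_eq_diagTerm (n : ℕ) :
    ∀ i, i ≤ n → poch (1 / 2) n ^ 2 / ((n.factorial : ℕ) : ℚ) ^ 2
        * (f32Aux n n ((n : ℚ) + 1 / 2) (1 / 2) (1 / 2) i).1 = diagTerm n i := by
  intro i
  induction i with
  | zero =>
    intro _
    have hf : (((n + 2).factorial : ℕ) : ℚ) = ((n : ℚ) + 2) * ((n : ℚ) + 1) * ((n.factorial : ℕ) : ℚ) := by
      rw [Nat.factorial_succ, Nat.factorial_succ]; push_cast; ring
    have hn : ((n.factorial : ℕ) : ℚ) ≠ 0 := by positivity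
    have h1 : ((n : ℚ) + 1) ≠ 0 := by positivity
    have h2 : ((n : ℚ) + 2) ≠ 0 := by positivity
    simp only [f32Aux, diagTerm, diagBase, poch, Nat.choose_zero_right, Nat.factorial_zero, Nat.cast_one, Nat.cast_zero,
      add_zero, sub_zero, one_pow, one_mul, mul_one]
    rw [hf]
    field_simp
  | succ i ih =>
    intro hi
    have hR := diagTerm_succ_right n i
    have hB : ((i : ℚ) + 1) * (1 / 2 + (i : ℚ)) * (1 / 2 + (i : ℚ)) ≠ 0 := by positivity
    rw [f32Aux_fst_succ, ← mul_assoc, ih (Nat.le_of_succ_le hi), mul_div_assoc', eq_comm, eq_div_iff hB]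
    linear_combination hR

/-- On the diagonal the terminating `₃F₂` is the plain sum of its `n+1` terms. -/
theorem f32_diag_eq_sum (n : ℕ) (a b₁ b₂ : ℚ) :
    f32 n n a b₁ b₂ = ∑ i ∈ range (n + 1), (f32Aux n n a b₁ b₂ i).1 := by
  rw [f32, min_self, f32Aux_snd_eq, Finset.sum_range_succ' (fun i => (f32Aux n n a b₁ b₂ i).1),
    show (f32Aux n n a b₁ b₂ 0).1 = 1 from rfl, add_comm]

/-- `D(n) = ((½)ₙ/n!)² · ₃F₂(−n,−n,n+½;½,½;1)`. -/
theorem diagSum_eq_f32 (n : ℕ) :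
    diagSum n = poch (1 / 2) n ^ 2 / ((n.factorial : ℕ) : ℚ) ^ 2 * f32 n n ((n : ℚ) + 1 / 2) (1 / 2) (1 / 2) := by
  unfold diagSum
  rw [f32_diag_eq_sum, Finset.mul_sum]
  refine Finset.sum_congr rfl fun i hi => ?_
  exact (f32Aux_fst_eq_diagTerm n i (Nat.lt_succ_iff.mp (Finset.mem_range.mp hi))).symm

/-- **The diagonal of the explicit `G`-coefficient**: `Q(n,n,n,n,n) = 8(−1)ⁿ D(n)`. -/
theorem catalanQ_diagonal (n : ℕ) : catalanQ n n n n n = 8 * (-1) ^ n * diagSum n := by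
  have hS : n + n - n = n := Nat.add_sub_cancel n n
  have hg : gammaHalfRatio 0 = 1 := by simp [gammaHalfRatio, poch]
  have hsign : ((-1 : ℚ)) ^ (n + n + n) = (-1) ^ n := by
    rw [show n + n + n = 2 * n + n by ring, pow_add, pow_mul]; norm_num
  rw [diagSum_eq_f32]
  change 8 * (-1) ^ (n + n + (n + n - n)) * poch (1 / 2) n * poch (1 / 2) n * gammaHalfRatio ((n : ℤ) - n)
      * gammaHalfRatio ((n : ℤ) - ((n + n - n : ℕ) : ℤ))
      / ((((n + n - n).factorial : ℕ) : ℚ) * (((n + n - n).factorial : ℕ) : ℚ))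
      * f32 n (n + n - n) ((n : ℚ) + 1 / 2) ((n : ℚ) - n + 1 / 2) ((n : ℚ) - ((n + n - n : ℕ) : ℚ) + 1 / 2) = _
  rw [hS]
  simp only [sub_self, zero_add, hg, hsign, mul_one]
  ring

/-! ### Creative telescoping: `D` solves Zudilin's recursion -/

/-- Leading coefficient `c₂(n) = (2n+3)²(2n+4)² p(n+1)` of the recursion at index `n+1`. -/
def diagRecHi (n : ℚ) : ℚ := (2 * n + 3) ^ 2 * (2 * n + 4) ^ 2 * (20 * n ^ 2 + 32 * n + 13)

/-- Middle coefficient `c₁(n) = q(n+1)`. -/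
def diagRecMid (n : ℚ) : ℚ :=
  3520 * n ^ 6 + 26752 * n ^ 5 + 83024 * n ^ 4 + 134592 * n ^ 3 + 120196 * n ^ 2 + 56088 * n + 10699

/-- Trailing coefficient `c₀(n) = (2n+1)²(2n+2)² p(n+2)`. -/
def diagRecLo (n : ℚ) : ℚ := (2 * n + 1) ^ 2 * (2 * n + 2) ^ 2 * (20 * n ^ 2 + 72 * n + 65)

/-- The certificate polynomial `P₇(n,i)` (found by linear algebra over `ℚ`; degree 7 in `n`, 2 in `i`). -/
def diagCertPoly (n i : ℚ) : ℚ :=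
  -3520 * n ^ 7 + 1920 * n ^ 6 * i + 320 * n ^ 5 * i ^ 2 - 30432 * n ^ 6 + 12352 * n ^ 5 * i + 1952 * n ^ 4 * i ^ 2
    - 109040 * n ^ 5 + 31280 * n ^ 4 * i + 4560 * n ^ 3 * i ^ 2 - 209192 * n ^ 4 + 39552 * n ^ 3 * i
    + 5064 * n ^ 2 * i ^ 2 - 231368 * n ^ 3 + 26120 * n ^ 2 * i + 2656 * n * i ^ 2 - 147196 * n ^ 2 + 8476 * n * i
    + 520 * i ^ 2 - 49818 * n + 1053 * i - 6916

/-- The telescoping certificate `G(n,i) = B(n,i)·P₇(n,i)·(i−½)²·i`. -/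
def diagCert (n i : ℕ) : ℚ := diagBase n i * diagCertPoly n i * ((i : ℚ) - 1 / 2) ^ 2 * i

/-- The polynomial identity behind the certificate (everything divided by `B(n,i)`). -/
theorem diagKey (n i : ℚ) :
    diagRecHi n * ((n + 1 / 2) * (n + 3 / 2) * (n + i + 1 / 2) * (n + i + 3 / 2))
      - diagRecMid n * ((n + 1 / 2) * (n + i + 1 / 2) * (n + 2 - i) ^ 2)
      - diagRecLo n * ((n + 2 - i) * (n + 1 - i)) ^ 2
      - (diagCertPoly n (i + 1) * ((n + i + 1 / 2) * (n + 2 - i) ^ 2) - diagCertPoly n i * (i - 1 / 2) ^ 2 * i) = 0 := by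
  unfold diagRecHi diagRecMid diagRecLo diagCertPoly
  ring

/-- **Termwise telescoping**: `c₂ F(n+2,i) − c₁ F(n+1,i) − c₀ F(n,i) = G(n,i+1) − G(n,i)` for all `n, i`. -/
theorem telescope_term (n i : ℕ) :
    diagRecHi n * diagTerm (n + 2) i - diagRecMid n * diagTerm (n + 1) i - diagRecLo n * diagTerm n i
      = diagCert n (i + 1) - diagCert n i := by
  have h1 := diagBase_succ_left n i
  have h2 := diagBase_succ_left (n + 1) i
  have h3 := diagBase_succ_right n i
  have hK := diagKey (n : ℚ) (i : ℚ)
  rw [show n + 1 + 1 = n + 2 from rfl] at h2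
  unfold diagTerm diagCert
  push_cast at h1 h2 h3 ⊢
  linear_combination (diagRecHi (n : ℚ) * ((n : ℚ) + 3 - i) ^ 2) * h2
    + (diagRecHi (n : ℚ) * ((n : ℚ) + 3 / 2) * ((n : ℚ) + i + 3 / 2) - diagRecMid (n : ℚ) * ((n : ℚ) + 2 - i) ^ 2) * h1
    + (-(diagCertPoly (n : ℚ) ((i : ℚ) + 1))) * h3 + (diagBase n i) * hK

/-- `G(n,0) = 0`. -/
theorem diagCert_zero (n : ℕ) : diagCert n 0 = 0 := by
  simp [diagCert]

/-- `G(n,n+3) = 0` (the binomial vanishes). -/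
theorem diagCert_top (n : ℕ) : diagCert n (n + 3) = 0 := by
  simp [diagCert, diagBase]

/-- `F(n,n+1) = 0`. -/
theorem diagTerm_succ_self (n : ℕ) : diagTerm n (n + 1) = 0 := by
  unfold diagTerm; push_cast; ring

/-- `F(n,n+2) = 0`. -/
theorem diagTerm_succ_succ_self (n : ℕ) : diagTerm n (n + 2) = 0 := by
  unfold diagTerm; push_cast; ring

/-- `D(n)` as a sum over `i ≤ n+2` (two vanishing terms appended). -/
theorem diagSum_eq_sum₃ (n : ℕ) : diagSum n = ∑ i ∈ range (n + 3), diagTerm n i := by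
  rw [diagSum, Finset.sum_range_succ _ (n + 2), Finset.sum_range_succ _ (n + 1), diagTerm_succ_self,
    diagTerm_succ_succ_self, add_zero, add_zero]

/-- `D(n+1)` as a sum over `i ≤ n+2` (one vanishing term appended). -/
theorem diagSum_succ_eq_sum₃ (n : ℕ) : diagSum (n + 1) = ∑ i ∈ range (n + 3), diagTerm (n + 1) i := by
  have h : diagTerm (n + 1) (n + 2) = 0 := by unfold diagTerm; push_cast; ring
  rw [diagSum, Finset.sum_range_succ _ (n + 2), h, add_zero]

/-- `D(n+2)` is a sum over `i ≤ n+2` by definition. -/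
theorem diagSum_succ_succ_eq_sum₃ (n : ℕ) : diagSum (n + 2) = ∑ i ∈ range (n + 3), diagTerm (n + 2) i := rfl

/-- **The recursion**: `c₂(n) D(n+2) − c₁(n) D(n+1) − c₀(n) D(n) = 0` for all `n`. -/
theorem diagSum_rec (n : ℕ) : diagRecHi n * diagSum (n + 2) - diagRecMid n * diagSum (n + 1) - diagRecLo n * diagSum n = 0 := by
  have hsum : diagRecHi n * diagSum (n + 2) - diagRecMid n * diagSum (n + 1) - diagRecLo n * diagSum n
      = ∑ i ∈ range (n + 3), (diagCert n (i + 1) - diagCert n i) := by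
    rw [diagSum_succ_succ_eq_sum₃, diagSum_succ_eq_sum₃, diagSum_eq_sum₃, Finset.mul_sum, Finset.mul_sum,
      Finset.mul_sum, ← Finset.sum_sub_distrib, ← Finset.sum_sub_distrib]
    exact Finset.sum_congr rfl fun i _ => telescope_term n i
  rw [hsum, Finset.sum_range_sub, diagCert_top, diagCert_zero, sub_zero]

/-- **`D` solves Zudilin's difference equation (2).** -/
theorem diagSum_isSolution : Zudilin2003.IsSolution diagSum := by
  intro n hn
  obtain ⟨m, rfl⟩ : ∃ m, n = m + 1 := ⟨n - 1, by omega⟩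
  have h := diagSum_rec m
  unfold diagRecHi diagRecMid diagRecLo at h
  simp only [Nat.add_sub_cancel, show m + 1 + 1 = m + 2 from rfl]
  unfold Zudilin2003.p Zudilin2003.q
  push_cast
  linear_combination h

/-- **`D = u`**: the diagonal sum is Zudilin's `uₙ` (same recursion, same initial data). -/
theorem diagSum_eq_u : diagSum = Zudilin2003.u :=
  diagSum_isSolution.ext_of_init (Zudilin2003.sol_isSolution 1 (7 / 4))
    (by rw [diagSum_zero]; rfl) (by rw [diagSum_one]; rfl)

/-! ### The law and corollaries -/

/-- **The diagonal law, for all `n`** (`CatalanQSum.DiagonalLaw`): `Q(n,n,n,n,n) = 8(−1)ⁿ uₙ`. -/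
theorem diagonalLaw_holds : DiagonalLaw := by
  intro n
  rw [catalanQ_diagonal, diagSum_eq_u]

/-- Zudilin's `uₙ` as an explicit single sum: `uₙ = Σ_{i ≤ n} F(n,i)`. -/
theorem zudilin_u_eq_diagSum (n : ℕ) : Zudilin2003.u n = ∑ i ∈ range (n + 1), diagTerm n i := by
  rw [← diagSum_eq_u]; rfl

/-- Zudilin's `uₙ` is a terminating `₃F₂(1)`: `uₙ = ((½)ₙ/n!)² · ₃F₂(−n, −n, n+½; ½, ½; 1)`. -/
theorem zudilin_u_eq_f32 (n : ℕ) :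
    Zudilin2003.u n = poch (1 / 2) n ^ 2 / ((n.factorial : ℕ) : ℚ) ^ 2 * f32 n n ((n : ℚ) + 1 / 2) (1 / 2) (1 / 2) := by
  rw [← diagSum_eq_u, diagSum_eq_f32]

/-- **Exact 2-adic valuation of Zudilin's `uₙ`, all `n`**: `v₂(uₙ) = 2·s₂(n) − 4n` (`s₂` = binary digit sum); in particular
`2^{4n} uₙ` is a 2-adic integer (Zudilin, Sect. 4, observed `2^{4n}uₙ ∈ ℤ`; the odd part of the denominator is not addressed here). -/
theorem padicValRat_zudilin_u (n : ℕ) :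
    padicValRat 2 (Zudilin2003.u n) = 2 * ((Nat.digits 2 n).sum : ℤ) - 4 * (n : ℤ) := by
  rcases Nat.eq_zero_or_pos n with rfl | hn
  · simp [Zudilin2003.u]
  have hlaw := twoAdicLaw_holds n n n n n (by omega) (by omega) (by omega) (by omega) (by omega)
  have hs : n + n - n = n := by omega
  rw [hs, diagonalLaw_holds n] at hlaw
  have hu : Zudilin2003.u n ≠ 0 := (Zudilin2003.u_pos_and_v_succ_pos n).1.ne'
  have hm1 : ((-1 : ℚ)) ^ n ≠ 0 := pow_ne_zero _ (by norm_num)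
  have h8 : (8 : ℚ) ≠ 0 := by norm_num
  have hm1v : padicValRat 2 (((-1 : ℚ)) ^ n) = 0 := by
    rw [padicValRat.pow, padicValRat.neg, padicValRat.one, mul_zero]
  rw [padicValRat.mul (mul_ne_zero h8 hm1) hu, padicValRat.mul h8 hm1, padicValRat_two_eight, hm1v] at hlaw
  omega

end Summit.KontsevichZagierPeriods.Zeta5Search.CatalanQSumDiagonal
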